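import Summits.KontsevichZagierPeriods.KontsevichZagierPeriods.Theorems.LinRedNormalFormArrangementNormalFormStubUnletterSimplex

/-!
# `ArrangementNormalForm` (stmt-KontsevichZagierPeriods-3915), line `janus-bands`, stub `stub_unletter` — (2/5) necessity of admissibility; the simplex as an order cell

Support file for `stub_unletter` (Janus band representations of base dimension `0` are congruent,
modulo `KZ.relations`, to `ℤ`-combinations of LETTERED ORDER CELLS).  The normal form of the whole
argument is a representation on the open ordered simplex
`Δ_w = KZ.openOrderedSimplex w = {1 > t₀ > ⋯ > t_{w-1} > 0}` with integrand
`cint G a t = G(t) · ∏ᵢ lett (a i) (tᵢ)` (`G` a polynomial over `ℚ`, `a i : Option ℚ` an optional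
simple constant letter, `lett (some c) x = 1/(x - c)`, `lett none x = 1`); the letters are ADMISSIBLE
(`Adm`) when none lies in `(0, 1)`, the top coordinate `t₀` is not lettered `1` and the bottom
coordinate `t_{w-1}` is not lettered `0`.  All helper declarations live in the sub-namespace
`…JanusBands.Unletter`.

This file: NECESSITY of admissibility for a pure product `q ∏ lett (a i)` (`q ≠ 0`) absolutely
integrable on `Δ_w` (`adm_of_integrableOn`: a thin box of the simplex adjacent to the offending
letter reduces to `∫ dx/|x - c| = ∞`, `intervalIntegrable_sub_inv_iff`); the working subgroup `RS`;
the simplex as a lettered order cell (`of_mem_JwSet`); inserting a coordinate into the simplex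
(`insertNth_mem_simplex_iff`).

References: M. Kontsevich, D. Zagier, *Periods* (2001), §1.2; D. Zagier, *Values of zeta functions
and their applications* (1994), §9 (convergence of iterated integrals).
-/

noncomputable section

open Set MeasureTheory MvPolynomial
open Literature.NumberTheory.Transcendental
open Literature.ModelTheory.ExponentialFields (IsSemialgebraic)

namespace Summit.KontsevichZagierPeriods.ArrangementNormalForm.JanusBands

/-- Registered support goal of this file: thin boxes around strictly decreasing, equally spaced
centres lie in the open ordered simplex. -/
theorem unletter_pi_subset_simplex (n : ℕ) (T δ : ℝ) (htop : T + δ / 2 ≤ 1) (hbot : 0 ≤ T - n * δ - δ / 2) : Set.pi Set.univ (fun j : Fin (n + 1) => Set.Ioo (T - j * δ - δ / 2) (T - j * δ + δ / 2)) ⊆ KZ.openOrderedSimplex (n + 1) := by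
  intro z hz
  simp only [mem_pi, mem_univ, true_implies, mem_Ioo] at hz
  have hδ : 0 ≤ δ := by
    have h := hz 0; simp only [Fin.val_zero, Nat.cast_zero, zero_mul, sub_zero] at h; linarith
  refine ⟨fun j => ?_, fun j => ?_, fun j j' hjj' => ?_⟩
  · have hj : (j : ℝ) ≤ n := by exact_mod_cast Fin.is_le j
    nlinarith [(hz j).1]
  · have hj : (0 : ℝ) ≤ j := Nat.cast_nonneg _
    nlinarith [(hz j).2]
  · have h : (j : ℝ) + 1 ≤ j' := by exact_mod_cast (Fin.lt_def.1 hjj' : (j : ℕ) < j')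
    have h' : ((j : ℝ) + 1) * δ ≤ j' * δ := mul_le_mul_of_nonneg_right h hδ
    rw [add_mul, one_mul] at h'
    linarith [(hz j).1, (hz j').2]

namespace Unletter

/-! ### Necessity of admissibility for pure products -/

/-- `0 < betaF`. -/
theorem betaF_pos (o : Option ℚ) : 0 < betaF o := by
  cases o with
  | none => simp [betaF]
  | some c => simp only [betaF, Option.elim_some]; positivity

/-- `betaF (a j) ≤ |lett (a j) x|` for `x ∈ (0, 1)` not equal to the letter. -/
theorem betaF_le_abs_lett {o : Option ℚ} {x : ℝ} (hx : x ∈ Ioo (0:ℝ) 1)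
    (hne : ∀ c, o = some c → x ≠ c) : betaF o ≤ |lett o x| := by
  cases o with
  | none => simp [betaF]
  | some c =>
    rw [lett_some, abs_div, abs_one]
    refine one_div_le_one_div_of_le (abs_pos.2 (sub_ne_zero.2 (hne c rfl))) ?_
    calc |x - c| ≤ |x| + |(c : ℝ)| := abs_sub _ _
      _ ≤ 1 + |(c : ℝ)| := by rw [abs_of_pos hx.1]; linarith [hx.2]

/-- Core of the necessity argument: if the coordinate `i₀` is lettered `c` and a thin box of the
simplex has its `i₀`-side adjacent to (or around) `c`, the pure product `q ∏ lett` (`q ≠ 0`) is not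
integrable on the simplex (`∫ dx/|x - c|` diverges at `c`). -/
theorem not_integrableOn_of_box {n : ℕ} {a : Fin (n + 1) → Option ℚ} {q : ℚ} (hq : q ≠ 0)
    {i₀ : Fin (n + 1)} {c : ℚ} (hc : a i₀ = some c) (T δ : ℝ) (hδ : 0 < δ)
    (htop : T + δ / 2 ≤ 1) (hbot : 0 ≤ T - n * δ - δ / 2)
    (hcI : (c : ℝ) ∈ Icc (T - i₀ * δ - δ / 2) (T - i₀ * δ + δ / 2)) :
    ¬ IntegrableOn (cint (C q) a) (KZ.openOrderedSimplex (n + 1)) := by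
  classical
  intro hint
  set I : Fin (n + 1) → Set ℝ := fun j => Ioo (T - j * δ - δ / 2) (T - j * δ + δ / 2) with hI
  have hbox : Set.pi univ I ⊆ KZ.openOrderedSimplex (n + 1) :=
    unletter_pi_subset_simplex n T δ htop hbot
  have hboxm : MeasurableSet (Set.pi univ I) := MeasurableSet.univ_pi fun j => measurableSet_Ioo
  have h1 := hint.mono_set hbox
  -- the a.e. lower bound
  set β : ℝ := ∏ j ∈ Finset.univ.erase i₀, betaF (a j) with hβ
  have hβpos : 0 < β := Finset.prod_pos fun j _ => betaF_pos _
  have hqβ : 0 < |(q : ℝ)| * β := mul_pos (abs_pos.2 (by exact_mod_cast hq)) hβpos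
  have hae : ∀ᵐ z ∂(volume.restrict (Set.pi univ I)),
      ‖(|z i₀ - (c : ℝ)|)⁻¹‖ ≤ (|(q : ℝ)| * β)⁻¹ * ‖cint (C q) a z‖ := by
    have hne : ∀ᵐ z : Fin (n + 1) → ℝ, ∀ j, ∀ c', a j = some c' → z j ≠ (c' : ℝ) := by
      rw [ae_all_iff]
      intro j
      cases haj : a j with
      | none => exact Filter.Eventually.of_forall fun z c' h => by cases h
      | some c' =>
        have := Measure.ae_eval_ne (fun _ : Fin (n + 1) => (volume : Measure ℝ)) j (c' : ℝ)
        rw [← volume_pi] at this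
        filter_upwards [this] with z hz c'' h
        cases h; exact hz
    filter_upwards [ae_restrict_mem hboxm, ae_restrict_of_ae hne] with z hz hzne
    have hzΔ := hbox hz
    rw [Real.norm_eq_abs, abs_inv, abs_abs, Real.norm_eq_abs, cint, abs_mul, Finset.abs_prod,
      ← Finset.mul_prod_erase _ _ (Finset.mem_univ i₀), hc, lett_some, abs_div, abs_one,
      one_div]
    have hq' : |(aeval z (C q : MvPolynomial (Fin (n + 1)) ℚ) : ℝ)| = |(q : ℝ)| := by simp
    rw [hq']
    have hprod : β ≤ ∏ j ∈ Finset.univ.erase i₀, |lett (a j) (z j)| :=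
      Finset.prod_le_prod (fun j _ => (betaF_pos _).le) fun j _ =>
        betaF_le_abs_lett ⟨hzΔ.1 j, hzΔ.2.1 j⟩ fun c' h => hzne j c' h
    rw [le_inv_mul_iff₀ hqβ]
    calc |(q : ℝ)| * β * (|z i₀ - (c : ℝ)|)⁻¹ = |(q : ℝ)| * ((|z i₀ - (c : ℝ)|)⁻¹ * β) := by ring
      _ ≤ |(q : ℝ)| * ((|z i₀ - (c : ℝ)|)⁻¹ * ∏ j ∈ Finset.univ.erase i₀, |lett (a j) (z j)|) :=
        mul_le_mul_of_nonneg_left (mul_le_mul_of_nonneg_left hprod (inv_nonneg.2 (abs_nonneg _)))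
          (abs_nonneg _)
  have hm1 : Measurable fun x : ℝ => (|x - (c : ℝ)|)⁻¹ :=
    (continuous_abs.measurable.comp (measurable_id.sub_const _)).inv
  have hm2 : Measurable fun z : Fin (n + 1) → ℝ => (|z i₀ - (c : ℝ)|)⁻¹ :=
    hm1.comp (measurable_pi_apply i₀)
  have h2 : IntegrableOn (fun z : Fin (n + 1) → ℝ => (|z i₀ - (c : ℝ)|)⁻¹) (Set.pi univ I) :=
    Integrable.mono' (h1.norm.const_mul _) hm2.aestronglyMeasurable hae
  -- down to one variable
  have h3 : IntegrableOn (fun x : ℝ => (|x - (c : ℝ)|)⁻¹)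
      (Ioo (T - i₀ * δ - δ / 2) (T - i₀ * δ + δ / 2)) := by
    refine unletter_integrableOn_pi _ I i₀ _ hm1 (fun j => ?_) (fun j => ?_) h2
    · simp only [hI, Real.volume_Ioo]; rw [ENNReal.ofReal_ne_zero_iff]; linarith  -- (T - jδ + δ/2) - (T - jδ - δ/2) = δ
    · simp [hI, Real.volume_Ioo]
  have hle : T - i₀ * δ - δ / 2 ≤ T - i₀ * δ + δ / 2 := by linarith
  have h4 : IntervalIntegrable (fun x : ℝ => (x - (c : ℝ))⁻¹) volume (T - i₀ * δ - δ / 2)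
      (T - i₀ * δ + δ / 2) := by
    rw [intervalIntegrable_iff_integrableOn_Ioo_of_le hle]
    have hm3 : AEStronglyMeasurable (fun x : ℝ => (x - (c : ℝ))⁻¹)
        (volume.restrict (Ioo (T - i₀ * δ - δ / 2) (T - i₀ * δ + δ / 2))) :=
      ((measurable_id.sub_const (c : ℝ)).inv).aestronglyMeasurable
    refine (integrable_norm_iff hm3).1 ?_
    have : (fun x : ℝ => ‖(x - (c : ℝ))⁻¹‖) = fun x => (|x - (c : ℝ)|)⁻¹ := by
      ext x; simp [Real.norm_eq_abs]
    rw [this]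
    exact h3
  rcases intervalIntegrable_sub_inv_iff.1 h4 with h | h
  · linarith
  · exact h (by rwa [uIcc_of_le hle])

/-- **Necessity of admissibility.** A pure product `q ∏ᵢ lett (a i) (tᵢ)` with `q ≠ 0` which is
absolutely integrable on the simplex has admissible letters. -/
theorem adm_of_integrableOn {w : ℕ} {a : Fin w → Option ℚ} {q : ℚ} (hq : q ≠ 0)
    (hint : IntegrableOn (cint (C q) a) (KZ.openOrderedSimplex w)) : a ∈ Adm w := by
  by_contra hna
  rw [mem_Adm] at hna
  push Not at hna
  obtain ⟨i₀, c, hc, h⟩ := hna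
  obtain ⟨n, rfl⟩ : ∃ n, w = n + 1 := ⟨w - 1, by have := i₀.2; omega⟩
  have hn : (0 : ℝ) < n + 1 := by positivity
  have hi₀ : (i₀ : ℝ) ≤ n := by exact_mod_cast Fin.is_le i₀
  have hi₀' : (0 : ℝ) ≤ i₀ := Nat.cast_nonneg _
  by_cases hP : c ≤ 0 ∨ 1 ≤ c
  · by_cases hQ : (i₀ : ℕ) = 0 → c ≠ 1
    · -- bottom letter `0`
      obtain ⟨hi, rfl⟩ := h hP hQ
      have hi' : (i₀ : ℝ) = n := by
        have : (i₀ : ℕ) = n := by omega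
        exact_mod_cast this
      refine not_integrableOn_of_box hq hc (n * (1 / (n + 1)) + (1 / (n + 1)) / 2) (1 / (n + 1))
        (by positivity) (le_of_eq ?_) (le_of_eq ?_) ⟨le_of_eq ?_, ?_⟩ hint
      · field_simp; ring
      · ring
      · rw [hi']; push_cast; ring
      · rw [hi']; push_cast; have : (0:ℝ) < 1 / (n + 1) := by positivity
        linarith
    · -- top letter `1`
      push Not at hQ
      obtain ⟨hi, rfl⟩ := hQ
      have hi' : (i₀ : ℝ) = 0 := by exact_mod_cast hi
      refine not_integrableOn_of_box hq hc (1 - (1 / (n + 1)) / 2) (1 / (n + 1))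
        (by positivity) (le_of_eq ?_) (le_of_eq ?_) ⟨?_, le_of_eq ?_⟩ hint
      · ring
      · field_simp; ring
      · rw [hi']; push_cast; have : (0:ℝ) < 1 / (n + 1) := by positivity
        linarith
      · rw [hi']; push_cast; ring
  · -- interior letter
    push Not at hP
    obtain ⟨hc0, hc1⟩ := hP
    have hc0' : (0 : ℝ) < c := by exact_mod_cast hc0
    have hc1' : (c : ℝ) < 1 := by exact_mod_cast hc1
    set δ : ℝ := min (c : ℝ) (1 - c) / (n + 1) with hδ
    have hδpos : 0 < δ := by rw [hδ]; exact div_pos (lt_min hc0' (by linarith)) hn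
    have hδ1 : (n + 1) * δ ≤ c := by
      rw [hδ, mul_div_cancel₀ _ hn.ne']; exact min_le_left _ _
    have hδ2 : (n + 1) * δ ≤ 1 - c := by
      rw [hδ, mul_div_cancel₀ _ hn.ne']; exact min_le_right _ _
    refine not_integrableOn_of_box hq hc ((c : ℝ) + i₀ * δ) δ hδpos ?_ ?_ ⟨?_, ?_⟩ hint
    · nlinarith
    · nlinarith
    · linarith
    · linarith

/-! ## Part B: moves on lettered simplex representations -/

/-- Normalisation of the coercion `Fin k ⊕ ℚ → Fin k ⊕ ℝ` hidden in the bounds of `JwSet`. -/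
theorem sum_elim_coe {k : ℕ} (z : Fin k → ℝ) (v : Fin k ⊕ ℚ) :
    Sum.elim z (fun c => (c : ℝ)) v = Sum.elim z (fun c : ℚ => (c : ℝ)) v := by
  cases v <;> rfl

/-- Membership in `RS`, unfolded. -/
theorem mem_RS_iff {x : KZ.FormalRep} :
    x ∈ RS ↔ ∃ c ∈ AddSubgroup.closure JwSet, x - c ∈ KZ.relations := by
  rw [RS, AddSubgroup.mem_sup]
  constructor
  · rintro ⟨y, hy, z, hz, rfl⟩
    exact ⟨y, hy, by simpa using hz⟩
  · rintro ⟨c, hc, h⟩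
    exact ⟨c, hc, x - c, h, by abel⟩

/-- Relations lie in `RS`. -/
theorem mem_RS_of_mem_relations {x : KZ.FormalRep} (h : x ∈ KZ.relations) : x ∈ RS :=
  AddSubgroup.mem_sup_right h

/-- Generators lie in `RS`. -/
theorem mem_RS_of_mem_JwSet {x : KZ.FormalRep} (h : x ∈ JwSet) : x ∈ RS :=
  AddSubgroup.mem_sup_left (AddSubgroup.subset_closure h)

/-- `RS` is saturated for congruence modulo relations. -/
theorem mem_RS_of_sub_mem {x y : KZ.FormalRep} (h : x - y ∈ KZ.relations) (hy : y ∈ RS) : x ∈ RS := by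
  have : x = (x - y) + y := by abel
  rw [this]
  exact add_mem (mem_RS_of_mem_relations h) hy

/-! ### The simplex as a lettered order cell -/

/-- The open ordered simplex is the order cell with bounds `loIdx`, `hiIdx`. -/
theorem openOrderedSimplex_eq_cell (w : ℕ) : KZ.openOrderedSimplex w =
    {z | ∀ i, Sum.elim z (fun c : ℚ => (c : ℝ)) (loIdx w i) < z i ∧
      z i < Sum.elim z (fun c : ℚ => (c : ℝ)) (hiIdx w i)} := by
  ext z
  simp only [KZ.openOrderedSimplex, mem_setOf_eq]
  constructor
  · rintro ⟨h0, h1, hanti⟩ i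
    constructor
    · unfold loIdx
      split_ifs with h
      · exact hanti (Fin.lt_def.2 (by simp))
      · simpa using h0 i
    · unfold hiIdx
      split_ifs with h
      · simpa using h1 i
      · exact hanti (Fin.lt_def.2 (by simp; omega))
  · intro h
    rcases Nat.eq_zero_or_pos w with rfl | hw
    · exact ⟨fun i => i.elim0, fun i => i.elim0, fun i => i.elim0⟩
    obtain ⟨n, rfl⟩ : ∃ n, w = n + 1 := ⟨w - 1, by omega⟩
    have hanti : StrictAnti z := by
      rw [Fin.strictAnti_iff_succ_lt]
      intro j
      have := (h (Fin.castSucc j)).1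
      simp only [loIdx, Fin.val_castSucc, j.2, Nat.add_lt_add_iff_right, dif_pos] at this
      exact this
    have hlast : (0 : ℝ) < z (Fin.last n) := by
      have := (h (Fin.last n)).1
      simpa [loIdx] using this
    have hzero : z 0 < 1 := by
      have := (h 0).2
      simpa [hiIdx] using this
    exact ⟨fun i => hlast.trans_le (hanti.antitone (Fin.le_last i)),
      fun i => (hanti.antitone (Fin.zero_le i)).trans_lt hzero, hanti⟩

/-- A representation on the simplex with integrand `q ∏ 1/(tᵢ - αᵢ)` is a generator of `JwSet`. -/
theorem of_mem_JwSet {w : ℕ} (s : KZ.IntegralRep w) (q : ℚ) (α : Fin w → ℚ)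
    (hdom : s.domain = KZ.openOrderedSimplex w)
    (hint : EqOn s.integrand (fun t => (q : ℝ) * ∏ i, 1 / (t i - (α i : ℝ))) s.domain) :
    KZ.of s ∈ JwSet := by
  refine ⟨w, s, q, α, loIdx w, hiIdx w, ?_, ?_, hint, rfl⟩
  · rw [hdom]
    exact (isCompact_Icc (a := (0 : Fin w → ℝ)) (b := 1)).isBounded.subset fun t ht =>
      ⟨fun i => (ht.1 i).le, fun i => (ht.2.1 i).le⟩
  simp only [sum_elim_coe]
  rw [hdom, openOrderedSimplex_eq_cell]

/-! ### Inserting a coordinate into the simplex -/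

/-- Evaluation of `loP`. -/
theorem aeval_loP {n : ℕ} (u : Fin (n + 1)) (x : Fin n → ℝ) :
    (aeval x (loP u) : ℝ) = if h : (u : ℕ) < n then x ⟨u, h⟩ else 0 := by
  unfold loP; split_ifs <;> simp

/-- Evaluation of `upP`. -/
theorem aeval_upP {n : ℕ} (u : Fin (n + 1)) (x : Fin n → ℝ) :
    (aeval x (upP u) : ℝ) = if h : (u : ℕ) = 0 then 1 else x ⟨(u : ℕ) - 1, by omega⟩ := by
  unfold upP; split_ifs <;> simp

/-- Strict antitonicity of an inserted tuple. -/
theorem strictAnti_insertNth_iff {n : ℕ} (u : Fin (n + 1)) (c : ℝ) (x : Fin n → ℝ) :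
    StrictAnti (u.insertNth c x : Fin (n + 1) → ℝ) ↔ StrictAnti x ∧
      (∀ j : Fin n, Fin.castSucc j < u → c < x j) ∧ (∀ j : Fin n, u ≤ Fin.castSucc j → x j < c) := by
  constructor
  · intro h
    refine ⟨fun i j hij => ?_, fun j hj => ?_, fun j hj => ?_⟩
    · simpa using h (Fin.strictMono_succAbove u hij)
    · simpa using h ((Fin.succAbove_lt_iff_castSucc_lt u j).2 hj)
    · simpa using h ((Fin.lt_succAbove_iff_le_castSucc u j).2 hj)
  · rintro ⟨hx, h1, h2⟩ i i' hii'
    rcases Fin.eq_self_or_eq_succAbove u i' with h' | ⟨j', rfl⟩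
    · rw [h'] at hii' ⊢
      rcases Fin.eq_self_or_eq_succAbove u i with h | ⟨j, rfl⟩
      · exact absurd (h ▸ hii') (lt_irrefl _)
      · simpa using h1 j ((Fin.succAbove_lt_iff_castSucc_lt u j).1 hii')
    · rcases Fin.eq_self_or_eq_succAbove u i with h | ⟨j, rfl⟩
      · rw [h] at hii' ⊢
        simpa using h2 j' ((Fin.lt_succAbove_iff_le_castSucc u j').1 hii')
      · simpa using hx ((Fin.strictMono_succAbove u).lt_iff_lt.1 hii')

/-- Membership of an inserted tuple in the simplex: the remaining coordinates lie in the simplex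
and the inserted value lies strictly between its neighbours `loP u`, `upP u`. -/
theorem insertNth_mem_simplex_iff {n : ℕ} (u : Fin (n + 1)) (c : ℝ) (x : Fin n → ℝ) :
    (u.insertNth c x : Fin (n + 1) → ℝ) ∈ KZ.openOrderedSimplex (n + 1) ↔
      x ∈ KZ.openOrderedSimplex n ∧ (aeval x (loP u) : ℝ) < c ∧ c < aeval x (upP u) := by
  rw [aeval_loP, aeval_upP]
  simp only [KZ.openOrderedSimplex, mem_setOf_eq, Fin.forall_iff_succAbove u,
    Fin.insertNth_apply_same, Fin.insertNth_apply_succAbove, strictAnti_insertNth_iff]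
  constructor
  · rintro ⟨⟨hc0, hx0⟩, ⟨hc1, hx1⟩, hx, h1, h2⟩
    refine ⟨⟨hx0, hx1, hx⟩, ?_, ?_⟩
    · split_ifs with h
      · exact h2 ⟨u, h⟩ (by simp)
      · exact hc0
    · split_ifs with h
      · exact hc1
      · exact h1 ⟨(u : ℕ) - 1, by omega⟩ (by rw [Fin.lt_def]; simp only [Fin.val_castSucc]; omega)
  · rintro ⟨⟨hx0, hx1, hx⟩, hlo, hup⟩
    refine ⟨⟨?_, hx0⟩, ⟨?_, hx1⟩, hx, fun j hj => ?_, fun j hj => ?_⟩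
    · split_ifs at hlo with h
      · exact (hx0 _).trans hlo
      · exact hlo
    · split_ifs at hup with h
      · exact hup
      · exact hup.trans (hx1 _)
    · rw [Fin.lt_def, Fin.val_castSucc] at hj
      have hu : ¬ (u : ℕ) = 0 := by omega
      rw [dif_neg hu] at hup
      exact hup.trans_le (hx.antitone (by rw [Fin.le_def]; simp only; omega))
    · rw [Fin.le_def, Fin.val_castSucc] at hj
      have hu : (u : ℕ) < n := by omega
      rw [dif_pos hu] at hlo
      exact (hx.antitone (by rw [Fin.le_def]; simpa using hj)).trans_lt hlo

end Unletter

end Summit.KontsevichZagierPeriods.ArrangementNormalForm.JanusBands
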